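import Literature.MathematicalPhysics.PowerSystems.DVOCCollectiveAmplitudeDynamics
import HarnessLib

/-!
# Polynomial barrier bounds for the collective amplitude of the reduced dVOC network: on a face
# `r² = ρ²` with sync-distance `‖v‖²_S ≤ d²`, `Σ_iσ_i(v)σ_i(g(v)) ≥ Λ[α(ρ²((1−ρ²)Λ − 3d²) − ρd³/v_min) − 2ρdΣ̄]`
# (lower face), the mirror bound on an upper face, and the two-sided remainder
# `(Σ_iσ_iσ_i(g) − Λ²αr²(1−r²))² ≤ Λ²K_r‖v‖²_S` (Groß–Colombino–Brouillon–Dörfler 2019, model (17); every `N`)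

Topic `Literature/MathematicalPhysics/PowerSystems`, namespace
`Literature.MathematicalPhysics.PowerSystems.DvocReduced`; third of the four «collective-amplitude» modules
(`Gate` → `Dynamics` → **`Barrier`** → `Region`), continuing `DVOCCollectiveAmplitudeDynamics.lean`. MODELLED
column: pointwise statements about the printed reduced-order model (17), `M = DvocReduced N`; nothing here
says that a converter, feeder or grid is stable. 0 named facts, 0 `decide`, instance-free; every statement
PROVED (polynomial inequalities by `nlinarith`, Cauchy–Schwarz by `Finset.sum_mul_sq_le_sq_mul_sq`, no square
roots anywhere: faces are parametrised by `ρ`, `d`, `Σ̄` with `r² = ρ²`, `‖v‖²_S ≤ d²`, `Σ_k(σ_k/v_k⋆)² ≤ Σ̄²`).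
Cell G2-SCALE lead §58 D74 (idea card «idea-2 (cycle 5) / collective-amplitude-gate-printed-gain-certificate»,
crux K1 algebra «barrier_bound» REV 3 and crux K3 «band + remainder» REV 6; scratch by gridfusion-g2-idea-2,
`port/DVOCCollectiveAmplitudeGate.lean` 9a6b39836e226557 §3, checked rc 0 by gridfusion-g2-crit-1 STATUS
l.10652 / l.10675); typed by gridfusion-lit-4 (g15), 2026-08-28.

## Sources (read on the page)

* [GrossEtAl2019] arXiv:1802.08881 = IEEE TCNS 6 (2019) 1148: model (17) p0006 L9–16; `S`, `P_S`, `Λ` §IV-D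
  p0006 L37–46; Theorem 2 p0005 L69–76 (amplitude dynamics on `𝒮`: instability of `0_n`).
* [ColombinoEtAl2019] arXiv:1710.00694 = IEEE TAC 64 (2019) 4496: §4.3.2 chunk p0016 (tail) – p0017 L28–32,
  the printed INVARIANT NEIGHBOURHOOD of `𝒯`: «we define the function γ_𝒮(γ_𝒜) = (v⋆_min/v⋆_max)·γ_𝒜(v⋆_min −
  γ_𝒜)/σ̄(𝒦 − 𝓛) and the set ℳ(γ_𝒜) := {v̄ | ‖v̄‖_𝒮 ≤ γ_𝒮(γ_𝒜), ‖v̄_k‖_{𝒜_k} ≤ γ_𝒜 ∀k}» and Prop. 11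
  «Under Condition 1, the set ℳ(γ_𝒜) is non-empty and invariant … for all γ_𝒜 ∈ [0, ½v⋆_min)» — the
  nearest printed object: a PER-NODE amplitude gate under the FULL-gain Condition 1. The region used by this
  file's bounds (`r² = ρ²` collective amplitude, `‖v‖²_S ≤ d²`) and the explicit polynomial brackets are the
  idea card's, not printed.

## What is printed and what is this file's

PRINTED: (17); on `𝒮` the amplitude obeys the logistic law (tree §12), so `r² < 1 ⇒ d(r²)/dt > 0` there.
THIS FILE (proved, every `N`, symmetric `w`, `α ≥ 0`, `v_k⋆ ≥ v_min > 0`): starting from the `Dynamics`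
module's closed form `Σ_iσ_iσ_i(g) = Λα[r²(Λ(1−r²) − ‖δ‖²) − Σ_k(2a_k+b_k)a_k/v_k⋆²] + 2T`, three elementary
bounds — `|a_k| ≤ ρ d v_k⋆²/v_min` (from `a_k² ≤ r²v_k⋆²b_k`, `b_k ≤ ‖v‖²_S ≤ d²`, `v_k⋆ ≥ v_min`), hence
`Σ_k(2a_k+b_k)a_k/v_k⋆² ≤ (2ρ² + ρd/v_min)d²`; and Cauchy–Schwarz `T² ≤ Σ̄²Λ²ρ²d²` for the loading term
`T = Σ_k(σ_k/v_k⋆)(σ₁(R(−θ_k)δ_k)₂ − σ₂(R(−θ_k)δ_k)₁)` — give the LOWER-FACE bound `barrier_bound`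
(`Σ_iσ_iσ_i(g) ≥ Λ[α(ρ²((1−ρ²)Λ − 3d²) − ρd³/v_min) − 2ρdΣ̄]`; with `ρ² = 1 − ε₁`, `d² = 2ℓ` the bracket is
the card's barrier scalar `B_cs(ℓ, ε₁)`), the UPPER-FACE bound `barrier_bound_upper`
(`≤ Λ[α(ρ²(1−ρ²)Λ + ρd³/v_min) + 2ρdΣ̄]`, negative once `ρ² − 1 ≫ 1/Λ`), and inside a band `r² ≤ ρ₊²` the
TWO-SIDED REMAINDER `pairing_remainder_sq_le` (`(Σ_iσ_iσ_i(g) − Λ²αr²(1−r²))² ≤ Λ²K_r‖v‖²_S`,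
`K_r = 3((αρ₊²d)² + (α(2ρ₊²+ρ₊d/v_min)d)² + (2Σ̄ρ₊)²)`), The first summand `αρ²(1−ρ²)Λ²` is `N`-extensive (`Λ = Σv_k⋆²`);
the others are O(1) in `N` for fixed `d` — a statement about the bracket, not about the volume of any region.
Nothing here is a trajectory statement (module `Region`); nothing certifies a real grid.
-/

noncomputable section

namespace Literature.MathematicalPhysics.PowerSystems

open Finset Real

namespace DvocReduced

variable {N : ℕ} (W : DvocReduced N)

/-- **Barrier bound (pointwise, polynomial form, lower face).** On a state with collective amplitude
`r(v)² = ρ²` and sync-distance `‖v‖²_S ≤ d²`, for symmetric weights, `α ≥ 0`, `v_k* ≥ v_min > 0`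
and any loading enclosure `Σ_k (σ_k/v_k*)² ≤ Σ̄²`:
`Σ_i σ_i(v) σ_i(g(v)) ≥ Λ·[α(ρ²((1−ρ²)Λ − 3d²) − ρ d³/v_min) − 2 ρ d Σ̄]`.
With `ρ² = 1 − ε₁`, `d² = 2ℓ` the bracket is the idea card's barrier scalar `B_cs(ℓ, ε₁)`; by
`hasDerivWithinAt_rSq`, `B_cs > 0` makes `r²` strictly increasing at every point of the face
`{r² = 1 − ε₁} ∩ {½‖P_Sv‖² ≤ ℓ}`. This bound is the card's (proved here); the printed analogue of «stay close to
`𝒜` while close to `𝒮`» is [ColombinoEtAl2019, Prop. 11] (per-node amplitude gate, Condition 1).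
[cite: GrossEtAl2019, (17) p0006 L9–16 and Thm 2 p0005 L69–76 (amplitude dynamics on `𝒮`)] -/
theorem barrier_bound (hΛ : W.Lam ≠ 0) (hne : ∀ k, W.vref k ≠ 0) (hw : ∀ k j, W.w k j = W.w j k)
    (hα : 0 ≤ W.α) {vmin ρ d Sb : ℝ} (hvmin : 0 < vmin) (hv : ∀ k, vmin ≤ W.vref k)
    (hρ : 0 ≤ ρ) (hd : 0 ≤ d) (hSb : 0 ≤ Sb) (hσ : ∑ k, (W.loadSig k / W.vref k) ^ 2 ≤ Sb ^ 2)
    (v : DvocState N) (hr : W.rSq v = ρ ^ 2) (hδ : W.normS2 v ≤ d ^ 2) :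
    W.Lam * (W.α * (ρ ^ 2 * ((1 - ρ ^ 2) * W.Lam - 3 * d ^ 2) - ρ * d ^ 3 / vmin) - 2 * ρ * d * Sb)
      ≤ W.sig₁ v * W.sig₁ (W.gVec v) + W.sig₂ v * W.sig₂ (W.gVec v) := by
  rw [W.sig_pair_gVec_closed_form hΛ hne hw v]
  have hΛpos := W.Lam_pos_of_ne hΛ
  have hn : W.normS2 v = ∑ k, dvocNsq (W.projS v) k := W.normS2_eq_sum_nsq_projS hΛ v
  have hb0 : ∀ k, 0 ≤ dvocNsq (W.projS v) k := fun k => by unfold dvocNsq; positivity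
  have hbk : ∀ k, dvocNsq (W.projS v) k ≤ d ^ 2 := fun k => (W.nsq_projS_le_normS2 hΛ v k).trans hδ
  have hvpos : ∀ k, 0 < W.vref k := fun k => hvmin.trans_le (hv k)
  -- (ii)+(iii): the amplitude remainder `Σ_k (2a_k + b_k)a_k/v_k*² ≤ (2ρ² + ρd/v_min) d²`
  have ha_le : ∀ k, W.radDis v k ≤ ρ * d * W.vref k ^ 2 / vmin := by
    intro k
    have h1 := W.radDis_sq_le v k
    rw [hr] at h1
    have hM : 0 ≤ ρ * d * W.vref k ^ 2 / vmin := by positivity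
    have hvk : vmin ≤ W.vref k := hv k
    have hsq : W.radDis v k ^ 2 ≤ (ρ * d * W.vref k ^ 2 / vmin) ^ 2 := by
      have hv2 : W.vref k ^ 2 ≤ (W.vref k ^ 2 / vmin) ^ 2 := by
        rw [div_pow, le_div_iff₀ (by positivity)]
        have : vmin ^ 2 ≤ W.vref k ^ 2 := by nlinarith [hvpos k]
        nlinarith [sq_nonneg (W.vref k)]
      calc W.radDis v k ^ 2 ≤ ρ ^ 2 * W.vref k ^ 2 * dvocNsq (W.projS v) k := h1
        _ ≤ ρ ^ 2 * W.vref k ^ 2 * d ^ 2 := by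
            apply mul_le_mul_of_nonneg_left (hbk k); positivity
        _ = (ρ * d) ^ 2 * W.vref k ^ 2 := by ring
        _ ≤ (ρ * d) ^ 2 * (W.vref k ^ 2 / vmin) ^ 2 := by
            apply mul_le_mul_of_nonneg_left hv2; positivity
        _ = (ρ * d * W.vref k ^ 2 / vmin) ^ 2 := by ring
    exact (abs_le_of_sq_le_sq' hsq hM).2
  have hamp : ∑ k, (2 * W.radDis v k + dvocNsq (W.projS v) k) * W.radDis v k / W.vref k ^ 2
      ≤ (2 * ρ ^ 2 + ρ * d / vmin) * d ^ 2 := by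
    have hk : ∀ k, (2 * W.radDis v k + dvocNsq (W.projS v) k) * W.radDis v k / W.vref k ^ 2
        ≤ (2 * ρ ^ 2 + ρ * d / vmin) * dvocNsq (W.projS v) k := by
      intro k
      have hv2 : 0 < W.vref k ^ 2 := pow_pos (hvpos k) 2
      rw [div_le_iff₀ hv2]
      have h1 := W.radDis_sq_le v k
      rw [hr] at h1
      have h2 : W.radDis v k * dvocNsq (W.projS v) k
          ≤ ρ * d * W.vref k ^ 2 / vmin * dvocNsq (W.projS v) k :=
        mul_le_mul_of_nonneg_right (ha_le k) (hb0 k)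
      have h3 : (2 * ρ ^ 2 + ρ * d / vmin) * dvocNsq (W.projS v) k * W.vref k ^ 2
          = 2 * (ρ ^ 2 * W.vref k ^ 2 * dvocNsq (W.projS v) k)
            + ρ * d * W.vref k ^ 2 / vmin * dvocNsq (W.projS v) k := by ring
      rw [h3]
      nlinarith [h1, h2]
    calc ∑ k, (2 * W.radDis v k + dvocNsq (W.projS v) k) * W.radDis v k / W.vref k ^ 2
        ≤ ∑ k, (2 * ρ ^ 2 + ρ * d / vmin) * dvocNsq (W.projS v) k := Finset.sum_le_sum fun k _ => hk k
      _ = (2 * ρ ^ 2 + ρ * d / vmin) * W.normS2 v := by rw [← Finset.mul_sum, ← hn]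
      _ ≤ (2 * ρ ^ 2 + ρ * d / vmin) * d ^ 2 := by
          apply mul_le_mul_of_nonneg_left hδ; positivity
  -- (iv): the loading term by Cauchy–Schwarz, `|T| ≤ Σ̄ Λ ρ d`
  set T := ∑ k, W.loadSig k * (W.sig₁ v * W.rot₂ (W.projS v) k
      - W.sig₂ v * W.rot₁ (W.projS v) k) / W.vref k with hTdef
  have hT : T = ∑ k, (W.loadSig k / W.vref k)
      * (W.sig₁ v * W.rot₂ (W.projS v) k - W.sig₂ v * W.rot₁ (W.projS v) k) := by
    rw [hTdef]
    exact Finset.sum_congr rfl fun k _ => by ring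
  have hZ : W.sig₁ v ^ 2 + W.sig₂ v ^ 2 = W.Lam ^ 2 * ρ ^ 2 := by
    have := hr
    unfold rSq at this
    field_simp at this
    linear_combination this
  have hin : ∀ k, (W.sig₁ v * W.rot₂ (W.projS v) k - W.sig₂ v * W.rot₁ (W.projS v) k) ^ 2
      ≤ W.Lam ^ 2 * ρ ^ 2 * dvocNsq (W.projS v) k := by
    intro k
    rw [← hZ, ← W.rot_nsq (W.projS v) k]
    nlinarith [sq_nonneg (W.sig₁ v * W.rot₁ (W.projS v) k + W.sig₂ v * W.rot₂ (W.projS v) k)]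
  have hT2 : T ^ 2 ≤ (Sb * (W.Lam * ρ * d)) ^ 2 := by
    rw [hT]
    refine (Finset.sum_mul_sq_le_sq_mul_sq _ _ _).trans ?_
    have h2 : ∑ k, (W.sig₁ v * W.rot₂ (W.projS v) k - W.sig₂ v * W.rot₁ (W.projS v) k) ^ 2
        ≤ (W.Lam * ρ * d) ^ 2 := by
      calc ∑ k, (W.sig₁ v * W.rot₂ (W.projS v) k - W.sig₂ v * W.rot₁ (W.projS v) k) ^ 2
          ≤ ∑ k, W.Lam ^ 2 * ρ ^ 2 * dvocNsq (W.projS v) k := Finset.sum_le_sum fun k _ => hin k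
        _ = W.Lam ^ 2 * ρ ^ 2 * W.normS2 v := by rw [← Finset.mul_sum, ← hn]
        _ ≤ W.Lam ^ 2 * ρ ^ 2 * d ^ 2 := by
            apply mul_le_mul_of_nonneg_left hδ; positivity
        _ = (W.Lam * ρ * d) ^ 2 := by ring
    rw [mul_pow]
    exact mul_le_mul hσ h2 (Finset.sum_nonneg fun k _ => sq_nonneg _) (sq_nonneg _)
  have hTge : -(Sb * (W.Lam * ρ * d)) ≤ T := (abs_le_of_sq_le_sq' hT2 (by positivity)).1
  -- assemble
  rw [hr]
  have hΛα : 0 ≤ W.Lam * W.α := mul_nonneg hΛpos.le hα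
  have hρn : ρ ^ 2 * W.normS2 v ≤ ρ ^ 2 * d ^ 2 := mul_le_mul_of_nonneg_left hδ (sq_nonneg ρ)
  have hA : ρ ^ 2 * ((1 - ρ ^ 2) * W.Lam - 3 * d ^ 2) - ρ * d ^ 3 / vmin
      ≤ ρ ^ 2 * (W.Lam * (1 - ρ ^ 2) - W.normS2 v)
        - ∑ k, (2 * W.radDis v k + dvocNsq (W.projS v) k) * W.radDis v k / W.vref k ^ 2 := by
    have e : ρ * d ^ 3 / vmin = ρ * d / vmin * d ^ 2 := by ring
    rw [e]
    nlinarith [hamp, hρn]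
  have hB := mul_le_mul_of_nonneg_left hA hΛα
  nlinarith [hB, hTge]


/-- **Pointwise UPPER barrier on the over-voltage face `r² = ρ²` (`ρ² > 1` intended)**:
`Σ_iσ_iσ_i(g) ≤ Λ[α(ρ²(1−ρ²)Λ + ρd³/v_min) + 2ρdΣ̄]`, so `d(r²)/dt < 0` there once
`αρ²Λ(ρ² − 1) > αρd³/v_min + 2ρdΣ̄` (the card's mirror bound; same three elementary estimates).
[cite: GrossEtAl2019, (17) p0006 L9–16 and Thm 2 p0005 L69–76] -/
theorem barrier_bound_upper (hΛ : W.Lam ≠ 0) (hne : ∀ k, W.vref k ≠ 0) (hw : ∀ k j, W.w k j = W.w j k)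
    (hα : 0 ≤ W.α) {vmin ρ d Sb : ℝ} (hvmin : 0 < vmin) (hv : ∀ k, vmin ≤ W.vref k)
    (hρ : 0 ≤ ρ) (hd : 0 ≤ d) (hSb : 0 ≤ Sb) (hσ : ∑ k, (W.loadSig k / W.vref k) ^ 2 ≤ Sb ^ 2)
    (v : DvocState N) (hr : W.rSq v = ρ ^ 2) (hδ : W.normS2 v ≤ d ^ 2) :
    W.sig₁ v * W.sig₁ (W.gVec v) + W.sig₂ v * W.sig₂ (W.gVec v)
      ≤ W.Lam * (W.α * (ρ ^ 2 * ((1 - ρ ^ 2) * W.Lam) + ρ * d ^ 3 / vmin) + 2 * ρ * d * Sb) := by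
  rw [W.sig_pair_gVec_closed_form hΛ hne hw v]
  have hΛpos := W.Lam_pos_of_ne hΛ
  have hn : W.normS2 v = ∑ k, dvocNsq (W.projS v) k := W.normS2_eq_sum_nsq_projS hΛ v
  have hb0 : ∀ k, 0 ≤ dvocNsq (W.projS v) k := fun k => by unfold dvocNsq; positivity
  have hbk : ∀ k, dvocNsq (W.projS v) k ≤ d ^ 2 := fun k => (W.nsq_projS_le_normS2 hΛ v k).trans hδ
  have hvpos : ∀ k, 0 < W.vref k := fun k => hvmin.trans_le (hv k)
  have hn0 : 0 ≤ W.normS2 v := by rw [hn]; exact Finset.sum_nonneg fun k _ => hb0 k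
  -- |a_k| ≤ ρ d v_k*² / v_min
  have ha_abs : ∀ k, |W.radDis v k| ≤ ρ * d * W.vref k ^ 2 / vmin := by
    intro k
    have h1 := W.radDis_sq_le v k
    rw [hr] at h1
    have hM : 0 ≤ ρ * d * W.vref k ^ 2 / vmin := by positivity
    have hsq : W.radDis v k ^ 2 ≤ (ρ * d * W.vref k ^ 2 / vmin) ^ 2 := by
      have hv2 : W.vref k ^ 2 ≤ (W.vref k ^ 2 / vmin) ^ 2 := by
        rw [div_pow, le_div_iff₀ (by positivity)]
        have : vmin ^ 2 ≤ W.vref k ^ 2 := by nlinarith [hvpos k, hv k]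
        nlinarith [sq_nonneg (W.vref k)]
      calc W.radDis v k ^ 2 ≤ ρ ^ 2 * W.vref k ^ 2 * dvocNsq (W.projS v) k := h1
        _ ≤ ρ ^ 2 * W.vref k ^ 2 * d ^ 2 := by
            apply mul_le_mul_of_nonneg_left (hbk k); positivity
        _ = (ρ * d) ^ 2 * W.vref k ^ 2 := by ring
        _ ≤ (ρ * d) ^ 2 * (W.vref k ^ 2 / vmin) ^ 2 := by
            apply mul_le_mul_of_nonneg_left hv2; positivity
        _ = (ρ * d * W.vref k ^ 2 / vmin) ^ 2 := by ring
    exact abs_le.2 (abs_le_of_sq_le_sq' hsq hM)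
  -- −Σ (2a+b)a/v² ≤ (ρd/v_min) d²
  have hamp : -(∑ k, (2 * W.radDis v k + dvocNsq (W.projS v) k) * W.radDis v k / W.vref k ^ 2)
      ≤ ρ * d / vmin * d ^ 2 := by
    rw [← Finset.sum_neg_distrib]
    have hk : ∀ k, -((2 * W.radDis v k + dvocNsq (W.projS v) k) * W.radDis v k / W.vref k ^ 2)
        ≤ ρ * d / vmin * dvocNsq (W.projS v) k := by
      intro k
      have hv2 : 0 < W.vref k ^ 2 := pow_pos (hvpos k) 2
      rw [← neg_div, div_le_iff₀ hv2]
      have hab : |W.radDis v k| * dvocNsq (W.projS v) k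
          ≤ ρ * d * W.vref k ^ 2 / vmin * dvocNsq (W.projS v) k :=
        mul_le_mul_of_nonneg_right (ha_abs k) (hb0 k)
      have e : ρ * d / vmin * dvocNsq (W.projS v) k * W.vref k ^ 2
          = ρ * d * W.vref k ^ 2 / vmin * dvocNsq (W.projS v) k := by ring
      rw [e]
      nlinarith [sq_nonneg (W.radDis v k), neg_abs_le (W.radDis v k), le_abs_self (W.radDis v k), hb0 k]
    calc ∑ k, -((2 * W.radDis v k + dvocNsq (W.projS v) k) * W.radDis v k / W.vref k ^ 2)
        ≤ ∑ k, ρ * d / vmin * dvocNsq (W.projS v) k := Finset.sum_le_sum fun k _ => hk k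
      _ = ρ * d / vmin * W.normS2 v := by rw [← Finset.mul_sum, ← hn]
      _ ≤ ρ * d / vmin * d ^ 2 := by apply mul_le_mul_of_nonneg_left hδ; positivity
  -- loading term `T ≤ Σ̄ Λ ρ d`
  set T := ∑ k, W.loadSig k * (W.sig₁ v * W.rot₂ (W.projS v) k
      - W.sig₂ v * W.rot₁ (W.projS v) k) / W.vref k with hTdef
  have hT : T = ∑ k, (W.loadSig k / W.vref k)
      * (W.sig₁ v * W.rot₂ (W.projS v) k - W.sig₂ v * W.rot₁ (W.projS v) k) := by
    rw [hTdef]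
    exact Finset.sum_congr rfl fun k _ => by ring
  have hZ : W.sig₁ v ^ 2 + W.sig₂ v ^ 2 = W.Lam ^ 2 * ρ ^ 2 := by
    have := hr
    unfold rSq at this
    field_simp at this
    linear_combination this
  have hin : ∀ k, (W.sig₁ v * W.rot₂ (W.projS v) k - W.sig₂ v * W.rot₁ (W.projS v) k) ^ 2
      ≤ W.Lam ^ 2 * ρ ^ 2 * dvocNsq (W.projS v) k := by
    intro k
    rw [← hZ, ← W.rot_nsq (W.projS v) k]
    nlinarith [sq_nonneg (W.sig₁ v * W.rot₁ (W.projS v) k + W.sig₂ v * W.rot₂ (W.projS v) k)]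
  have hT2 : T ^ 2 ≤ (Sb * (W.Lam * ρ * d)) ^ 2 := by
    rw [hT]
    refine (Finset.sum_mul_sq_le_sq_mul_sq _ _ _).trans ?_
    have h2 : ∑ k, (W.sig₁ v * W.rot₂ (W.projS v) k - W.sig₂ v * W.rot₁ (W.projS v) k) ^ 2
        ≤ (W.Lam * ρ * d) ^ 2 := by
      calc ∑ k, (W.sig₁ v * W.rot₂ (W.projS v) k - W.sig₂ v * W.rot₁ (W.projS v) k) ^ 2
          ≤ ∑ k, W.Lam ^ 2 * ρ ^ 2 * dvocNsq (W.projS v) k := Finset.sum_le_sum fun k _ => hin k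
        _ = W.Lam ^ 2 * ρ ^ 2 * W.normS2 v := by rw [← Finset.mul_sum, ← hn]
        _ ≤ W.Lam ^ 2 * ρ ^ 2 * d ^ 2 := by
            apply mul_le_mul_of_nonneg_left hδ; positivity
        _ = (W.Lam * ρ * d) ^ 2 := by ring
    rw [mul_pow]
    exact mul_le_mul hσ h2 (Finset.sum_nonneg fun k _ => sq_nonneg _) (sq_nonneg _)
  have hTle : T ≤ Sb * (W.Lam * ρ * d) := (abs_le_of_sq_le_sq' hT2 (by positivity)).2
  -- assemble
  rw [hr]
  have hΛα : 0 ≤ W.Lam * W.α := mul_nonneg hΛpos.le hα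
  have hρn : 0 ≤ ρ ^ 2 * W.normS2 v := mul_nonneg (sq_nonneg ρ) hn0
  have hA : ρ ^ 2 * (W.Lam * (1 - ρ ^ 2) - W.normS2 v)
        - ∑ k, (2 * W.radDis v k + dvocNsq (W.projS v) k) * W.radDis v k / W.vref k ^ 2
      ≤ ρ ^ 2 * ((1 - ρ ^ 2) * W.Lam) + ρ * d ^ 3 / vmin := by
    have e : ρ * d ^ 3 / vmin = ρ * d / vmin * d ^ 2 := by ring
    rw [e]
    nlinarith [hamp, hρn]
  have hB := mul_le_mul_of_nonneg_left hA hΛα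
  nlinarith [hB, hTle]


set_option maxHeartbeats 800000 in
/-- **Two-sided remainder of the amplitude pairing inside the band** `r² ≤ ρ₊²`, `‖v‖²_S ≤ d²`:
`(Σ_iσ_iσ_i(g) − Λ²α r²(1−r²))² ≤ Λ²·K_r·‖v‖²_S`, `K_r = 3((αρ₊²d)² + (α(2ρ₊² + ρ₊d/v_min)d)² + (2Σ̄ρ₊)²)`
— the remainder is LINEAR in `‖P_S v‖`, stated through squares (no square roots); on `𝒮` it vanishes and the
pairing is the printed logistic drive `Λ²αr²(1−r²)`. [cite: GrossEtAl2019, (17) p0006 L9–16 and Thm 2 p0005 L69–76] -/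
theorem pairing_remainder_sq_le (hΛ : W.Lam ≠ 0) (hne : ∀ k, W.vref k ≠ 0) (hw : ∀ k j, W.w k j = W.w j k)
    {vmin ρp d Sb : ℝ} (hvmin : 0 < vmin) (hv : ∀ k, vmin ≤ W.vref k)
    (hρp : 0 ≤ ρp) (hd : 0 ≤ d) (hσ : ∑ k, (W.loadSig k / W.vref k) ^ 2 ≤ Sb ^ 2)
    (v : DvocState N) (hrp : W.rSq v ≤ ρp ^ 2) (hδ : W.normS2 v ≤ d ^ 2) :
    (W.sig₁ v * W.sig₁ (W.gVec v) + W.sig₂ v * W.sig₂ (W.gVec v)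
        - W.Lam ^ 2 * W.α * (W.rSq v * (1 - W.rSq v))) ^ 2
      ≤ W.Lam ^ 2 * (3 * ((W.α * ρp ^ 2 * d) ^ 2 + (W.α * (2 * ρp ^ 2 + ρp * d / vmin) * d) ^ 2
          + (2 * Sb * ρp) ^ 2)) * W.normS2 v := by
  rw [W.sig_pair_gVec_closed_form hΛ hne hw v]
  have hΛpos := W.Lam_pos_of_ne hΛ
  have hn : W.normS2 v = ∑ k, dvocNsq (W.projS v) k := W.normS2_eq_sum_nsq_projS hΛ v
  have hb0 : ∀ k, 0 ≤ dvocNsq (W.projS v) k := fun k => by unfold dvocNsq; positivity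
  have hbk : ∀ k, dvocNsq (W.projS v) k ≤ d ^ 2 := fun k => (W.nsq_projS_le_normS2 hΛ v k).trans hδ
  have hvpos : ∀ k, 0 < W.vref k := fun k => hvmin.trans_le (hv k)
  have hn0 : 0 ≤ W.normS2 v := by rw [hn]; exact Finset.sum_nonneg fun k _ => hb0 k
  have hr0 : 0 ≤ W.rSq v := by unfold rSq; positivity
  -- |a_k| ≤ ρ₊ d v_k*²/v_min and a_k² ≤ ρ₊² v_k*² b_k
  have ha_sq : ∀ k, W.radDis v k ^ 2 ≤ ρp ^ 2 * W.vref k ^ 2 * dvocNsq (W.projS v) k := by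
    intro k
    refine (W.radDis_sq_le v k).trans ?_
    apply mul_le_mul_of_nonneg_right _ (hb0 k)
    exact mul_le_mul_of_nonneg_right hrp (sq_nonneg _)
  have ha_abs : ∀ k, |W.radDis v k| ≤ ρp * d * W.vref k ^ 2 / vmin := by
    intro k
    have hM : 0 ≤ ρp * d * W.vref k ^ 2 / vmin := by positivity
    have hsq : W.radDis v k ^ 2 ≤ (ρp * d * W.vref k ^ 2 / vmin) ^ 2 := by
      have hv2 : W.vref k ^ 2 ≤ (W.vref k ^ 2 / vmin) ^ 2 := by
        rw [div_pow, le_div_iff₀ (by positivity)]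
        have : vmin ^ 2 ≤ W.vref k ^ 2 := by nlinarith [hvpos k, hv k]
        nlinarith [sq_nonneg (W.vref k)]
      calc W.radDis v k ^ 2 ≤ ρp ^ 2 * W.vref k ^ 2 * dvocNsq (W.projS v) k := ha_sq k
        _ ≤ ρp ^ 2 * W.vref k ^ 2 * d ^ 2 := by
            apply mul_le_mul_of_nonneg_left (hbk k); positivity
        _ = (ρp * d) ^ 2 * W.vref k ^ 2 := by ring
        _ ≤ (ρp * d) ^ 2 * (W.vref k ^ 2 / vmin) ^ 2 := by
            apply mul_le_mul_of_nonneg_left hv2; positivity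
        _ = (ρp * d * W.vref k ^ 2 / vmin) ^ 2 := by ring
    exact abs_le.2 (abs_le_of_sq_le_sq' hsq hM)
  -- |A| ≤ c₂ ‖v‖²_S,  A = Σ (2a+b)a/v²
  set A := ∑ k, (2 * W.radDis v k + dvocNsq (W.projS v) k) * W.radDis v k / W.vref k ^ 2 with hAdef
  have hAabs : |A| ≤ (2 * ρp ^ 2 + ρp * d / vmin) * W.normS2 v := by
    have hk : ∀ k, |(2 * W.radDis v k + dvocNsq (W.projS v) k) * W.radDis v k / W.vref k ^ 2|
        ≤ (2 * ρp ^ 2 + ρp * d / vmin) * dvocNsq (W.projS v) k := by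
      intro k
      have hv2 : 0 < W.vref k ^ 2 := pow_pos (hvpos k) 2
      rw [abs_div, abs_of_pos hv2, div_le_iff₀ hv2]
      have hab : |W.radDis v k| * dvocNsq (W.projS v) k
          ≤ ρp * d * W.vref k ^ 2 / vmin * dvocNsq (W.projS v) k :=
        mul_le_mul_of_nonneg_right (ha_abs k) (hb0 k)
      have e : (2 * ρp ^ 2 + ρp * d / vmin) * dvocNsq (W.projS v) k * W.vref k ^ 2
          = 2 * (ρp ^ 2 * W.vref k ^ 2 * dvocNsq (W.projS v) k)
            + ρp * d * W.vref k ^ 2 / vmin * dvocNsq (W.projS v) k := by ring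
      rw [e]
      have h3 : |(2 * W.radDis v k + dvocNsq (W.projS v) k) * W.radDis v k|
          ≤ 2 * W.radDis v k ^ 2 + |W.radDis v k| * dvocNsq (W.projS v) k := by
        rw [abs_le]
        constructor
        · nlinarith [sq_nonneg (W.radDis v k), neg_abs_le (W.radDis v k), le_abs_self (W.radDis v k), hb0 k,
            abs_nonneg (W.radDis v k)]
        · nlinarith [sq_nonneg (W.radDis v k), neg_abs_le (W.radDis v k), le_abs_self (W.radDis v k), hb0 k,
            abs_nonneg (W.radDis v k)]
      linarith [ha_sq k]
    calc |A| ≤ ∑ k, |(2 * W.radDis v k + dvocNsq (W.projS v) k) * W.radDis v k / W.vref k ^ 2| :=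
          Finset.abs_sum_le_sum_abs _ _
      _ ≤ ∑ k, (2 * ρp ^ 2 + ρp * d / vmin) * dvocNsq (W.projS v) k := Finset.sum_le_sum fun k _ => hk k
      _ = (2 * ρp ^ 2 + ρp * d / vmin) * W.normS2 v := by rw [← Finset.mul_sum, ← hn]
  -- T² ≤ Σ̄² Λ² ρ₊² ‖v‖²_S
  set T := ∑ k, W.loadSig k * (W.sig₁ v * W.rot₂ (W.projS v) k
      - W.sig₂ v * W.rot₁ (W.projS v) k) / W.vref k with hTdef
  have hT : T = ∑ k, (W.loadSig k / W.vref k)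
      * (W.sig₁ v * W.rot₂ (W.projS v) k - W.sig₂ v * W.rot₁ (W.projS v) k) := by
    rw [hTdef]
    exact Finset.sum_congr rfl fun k _ => by ring
  have hZ : W.sig₁ v ^ 2 + W.sig₂ v ^ 2 = W.Lam ^ 2 * W.rSq v := by
    unfold rSq
    field_simp
  have hin : ∀ k, (W.sig₁ v * W.rot₂ (W.projS v) k - W.sig₂ v * W.rot₁ (W.projS v) k) ^ 2
      ≤ W.Lam ^ 2 * ρp ^ 2 * dvocNsq (W.projS v) k := by
    intro k
    have h1 : (W.sig₁ v * W.rot₂ (W.projS v) k - W.sig₂ v * W.rot₁ (W.projS v) k) ^ 2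
        ≤ (W.sig₁ v ^ 2 + W.sig₂ v ^ 2) * dvocNsq (W.projS v) k := by
      rw [← W.rot_nsq (W.projS v) k]
      nlinarith [sq_nonneg (W.sig₁ v * W.rot₁ (W.projS v) k + W.sig₂ v * W.rot₂ (W.projS v) k)]
    rw [hZ] at h1
    refine h1.trans ?_
    apply mul_le_mul_of_nonneg_right _ (hb0 k)
    exact mul_le_mul_of_nonneg_left hrp (by positivity)
  have hT2 : T ^ 2 ≤ Sb ^ 2 * (W.Lam ^ 2 * ρp ^ 2 * W.normS2 v) := by
    rw [hT]
    refine (Finset.sum_mul_sq_le_sq_mul_sq _ _ _).trans ?_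
    have h2 : ∑ k, (W.sig₁ v * W.rot₂ (W.projS v) k - W.sig₂ v * W.rot₁ (W.projS v) k) ^ 2
        ≤ W.Lam ^ 2 * ρp ^ 2 * W.normS2 v := by
      calc ∑ k, (W.sig₁ v * W.rot₂ (W.projS v) k - W.sig₂ v * W.rot₁ (W.projS v) k) ^ 2
          ≤ ∑ k, W.Lam ^ 2 * ρp ^ 2 * dvocNsq (W.projS v) k := Finset.sum_le_sum fun k _ => hin k
        _ = W.Lam ^ 2 * ρp ^ 2 * W.normS2 v := by rw [← Finset.mul_sum, ← hn]
    exact mul_le_mul hσ h2 (Finset.sum_nonneg fun k _ => sq_nonneg _) (sq_nonneg _)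
  -- the three pieces
  have e : W.Lam * W.α * (W.rSq v * (W.Lam * (1 - W.rSq v) - W.normS2 v) - A) + 2 * T
        - W.Lam ^ 2 * W.α * (W.rSq v * (1 - W.rSq v))
      = -(W.Lam * W.α * W.rSq v * W.normS2 v) + -(W.Lam * W.α * A) + 2 * T := by ring
  rw [e]
  have h3sq : ∀ x y z : ℝ, (x + y + z) ^ 2 ≤ 3 * (x ^ 2 + y ^ 2 + z ^ 2) := by
    intro x y z; nlinarith [sq_nonneg (x - y), sq_nonneg (y - z), sq_nonneg (x - z)]
  refine (h3sq _ _ _).trans ?_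
  have p1 : (-(W.Lam * W.α * W.rSq v * W.normS2 v)) ^ 2 ≤ W.Lam ^ 2 * (W.α * ρp ^ 2 * d) ^ 2 * W.normS2 v := by
    have hrr : W.rSq v ^ 2 ≤ (ρp ^ 2) ^ 2 := pow_le_pow_left₀ hr0 hrp 2
    have hnn : W.normS2 v ^ 2 ≤ d ^ 2 * W.normS2 v := by nlinarith
    calc (-(W.Lam * W.α * W.rSq v * W.normS2 v)) ^ 2
        = W.Lam ^ 2 * W.α ^ 2 * W.rSq v ^ 2 * W.normS2 v ^ 2 := by ring
      _ ≤ W.Lam ^ 2 * W.α ^ 2 * (ρp ^ 2) ^ 2 * (d ^ 2 * W.normS2 v) := by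
          apply mul_le_mul (mul_le_mul_of_nonneg_left hrr (by positivity)) hnn (by positivity) (by positivity)
      _ = W.Lam ^ 2 * (W.α * ρp ^ 2 * d) ^ 2 * W.normS2 v := by ring
  have p2 : (-(W.Lam * W.α * A)) ^ 2 ≤ W.Lam ^ 2 * (W.α * (2 * ρp ^ 2 + ρp * d / vmin) * d) ^ 2 * W.normS2 v := by
    have hA2 : A ^ 2 ≤ ((2 * ρp ^ 2 + ρp * d / vmin) * W.normS2 v) ^ 2 :=
      sq_le_sq' (abs_le.1 hAabs).1 (abs_le.1 hAabs).2
    have hnn : W.normS2 v ^ 2 ≤ d ^ 2 * W.normS2 v := by nlinarith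
    calc (-(W.Lam * W.α * A)) ^ 2 = W.Lam ^ 2 * W.α ^ 2 * A ^ 2 := by ring
      _ ≤ W.Lam ^ 2 * W.α ^ 2 * ((2 * ρp ^ 2 + ρp * d / vmin) ^ 2 * (d ^ 2 * W.normS2 v)) := by
          apply mul_le_mul_of_nonneg_left _ (by positivity)
          calc A ^ 2 ≤ ((2 * ρp ^ 2 + ρp * d / vmin) * W.normS2 v) ^ 2 := hA2
            _ = (2 * ρp ^ 2 + ρp * d / vmin) ^ 2 * W.normS2 v ^ 2 := by ring
            _ ≤ (2 * ρp ^ 2 + ρp * d / vmin) ^ 2 * (d ^ 2 * W.normS2 v) :=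
                mul_le_mul_of_nonneg_left hnn (by positivity)
      _ = W.Lam ^ 2 * (W.α * (2 * ρp ^ 2 + ρp * d / vmin) * d) ^ 2 * W.normS2 v := by ring
  have p3 : (2 * T) ^ 2 ≤ W.Lam ^ 2 * (2 * Sb * ρp) ^ 2 * W.normS2 v := by
    have e2 : W.Lam ^ 2 * (2 * Sb * ρp) ^ 2 * W.normS2 v = 4 * (Sb ^ 2 * (W.Lam ^ 2 * ρp ^ 2 * W.normS2 v)) := by
      ring
    rw [e2]
    have e4 : (2 * T) ^ 2 = 4 * T ^ 2 := by ring
    rw [e4]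
    linarith [hT2]
  have e3 : W.Lam ^ 2 * (3 * ((W.α * ρp ^ 2 * d) ^ 2 + (W.α * (2 * ρp ^ 2 + ρp * d / vmin) * d) ^ 2
          + (2 * Sb * ρp) ^ 2)) * W.normS2 v
      = 3 * (W.Lam ^ 2 * (W.α * ρp ^ 2 * d) ^ 2 * W.normS2 v
          + W.Lam ^ 2 * (W.α * (2 * ρp ^ 2 + ρp * d / vmin) * d) ^ 2 * W.normS2 v
          + W.Lam ^ 2 * (2 * Sb * ρp) ^ 2 * W.normS2 v) := by ring
  rw [e3]
  linarith [p1, p2, p3]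

end DvocReduced

end Literature.MathematicalPhysics.PowerSystems
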